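import Summits.BirchSwinnertonDyer.BirchSwinnertonDyer.Theorems.PrintCFramBottomClassIndexLawFiveLeCuspSeedCutForm
import Summits.BirchSwinnertonDyer.BirchSwinnertonDyer.Theorems.PrintCFramBottomClassIndexLawFiveLeThetaCycleLegendreAtP
import Summits.BirchSwinnertonDyer.BirchSwinnertonDyer.Theorems.PrintCFramBottomClassIndexLawFiveLeHeegnerFieldSupplyCuspSplit
import HarnessLib

/-!
# Crux `PrintCFram.BottomClassIndexLawFiveLe` (stmt-BirchSwinnertonDyer-20372), line `eisenstein-resource-bdp-line` (registry v22):
# END STATE with BOTH print-derivable stubs replaced by typed hypotheses in q-expansion currency —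
# Stub C ⟸ (CutForm⁶) ∧ (CuspCutForm⁶) ∧ (SeedOffExc⁶); crux ⟸ prints5 ∧ KL ∧ (CutForm⁶) ∧ (CuspCutForm⁶) ∧ (SeedOffExc⁶) ∧ B1-level ∧ B1-sha
# (cell `bsd-print-cfram`, width seat `bsd-line-cfram-p1-w5` g5; THEOREMS ONLY, `--supports` 20372; BSD is not proved by any of this)

HONEST FRAMING. Pure composition; nothing is discharged here. Registry v22 (LEAD g12) carries two PRINT-DERIVABLE stubs with typing owed:
`stub_atP` (θ-cycle propagation at `p`) and `stub_cuspSeed` (the Eisenstein cusp seed). w8 g6 proved `stub_atP` ⟸ (CutForm⁶)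
(`ThetaCycle.atP_six_of_cutForm`, p686877: ONE hypothesis in q-expansion currency — the `m`-cut Cohen–Eisenstein series mod `p` inside a
Katz family, with the generalized-Bernoulli dictionary); this seat proved `stub_cuspSeed` ⟸ (CuspCutForm⁶) (`CuspSeed.cuspSeed_six_of_cutForm`:
the same cut series at the auxiliary datum `(3,0)` with the CUSP CONJUNCT «`G = 0 ⟹ ι C = 0`», the unit `C` being the kernel theorem p686210).
THIS FILE records the two compositions the registry can use: **Stub C ⟸ (CutForm⁶) ∧ (CuspCutForm⁶) ∧ (SeedOffExc⁶)**
(`stubC_of_cutForm_of_cuspCutForm_of_exc`, through LEAD g12's `HeegnerFieldSupply.stubC_of_atP_of_cuspSeed_of_exc`, p684982 — the composition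
typechecking CERTIFIES that `cuspSeed_six_of_cutForm` concludes the registered `hCusp` text verbatim) and the **END STATE**
`bottomClassIndexLawFiveLe_of_prints5_of_krizLi_of_cutForm_of_cuspCutForm_of_exc_of_level_of_sha` (crux BY NAME ⟸ the five refereed print
facts ∧ Kriz–Li Thm 1.20 ∧ (CutForm⁶) ∧ (CuspCutForm⁶) ∧ (SeedOffExc⁶) ∧ B1-level ∧ B1-sha, through LEAD g11's p677037). So on this line the
ANALYTIC side of the crux is: two TYPING items about ONE object (the cut Cohen series mod `p`: its existence in a Katz family with the
dictionary, and its constant term at the cusp `0`) + ONE thin research residue (SeedOffExc⁶: regular classes off the locus with a prime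
`ℓ ∣ m`, `ℓ ≡ ±1 (mod p)` — out of reach of cusp constants, crux notes w5g5 §12). CONDITIONAL on seven hypotheses; BSD is not proved by any
of this; no registered stub is closed. beyond-print theorem: NO.

References: [Cohen1975] Thm. 3.1; [Katz1973] §1.6; [Katz1977] Thm. (1)–(2); [KrizLi2019] Thm. 1.20; [MazurWiles1984] Thm. 2;
[BurungaleKobayashiNakamuraOta2026] §1.4; crux notes `Lines/eisenstein-resource-bdp-line-w5g5-cusp-seed.md`, `…-w8g6-notes.md`, `…-lead-g12.md`.
-/

set_option autoImplicit false
-- summit-side namespace `Summit.BirchSwinnertonDyer.BirchSwinnertonDyer.…` (single-conjunct summit, D-0017 layout)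
set_option linter.dupNamespace false

noncomputable section

open scoped Classical NumberTheorySymbols
open NumberField WeierstrassCurve DirichletCharacter Literature.NumberTheory.LFunctions
  Literature.NumberTheory.EllipticCurves Literature.NumberTheory.EllipticCurves.KrizLi2019
  Literature.NumberTheory.EllipticCurves.Rank1Residual Literature.NumberTheory.QuadraticFields

namespace Summit.BirchSwinnertonDyer.BirchSwinnertonDyer.Theorems.PrintCFram.CuspSeed

open Summit.BirchSwinnertonDyer.BirchSwinnertonDyer.Theorems.PrintCFram
open Summit.BirchSwinnertonDyer.BirchSwinnertonDyer.Theorems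
open PowerSeries

/-! ## §3 Stub C ⟸ (CutForm⁶) ∧ (CuspCutForm⁶) ∧ (SeedOffExc⁶) -/

/-- **Stub C VERBATIM ⟸ (CutForm⁶) ∧ (CuspCutForm⁶) ∧ (SeedOffExc⁶).** `hcut` = w8 g6's (CutForm⁶) (text of `ThetaCycle.atP_six_of_cutForm`),
`hcusp` = this seat's (CuspCutForm⁶) (text of `cuspSeed_six_of_cutForm`), `hExc` = registry v22's `stub_seedOffExc` VERBATIM. One line through
`HeegnerFieldSupply.stubC_of_atP_of_cuspSeed_of_exc` (LEAD g12). Nothing is discharged; BSD is not proved by any of this.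
[cite: Cohen1975, Thm. 3.1] [cite: Katz1973, §1.6] [cite: KrizLi2019, Thm. 1.20 (p. 8)] -/
theorem stubC_of_cutForm_of_cuspCutForm_of_exc
    (hcut : ∀ (p : ℕ) [Fact p.Prime] (m : ℕ) [NeZero m] (χ : DirichletCharacter ℚ_[p] m) (k : ℕ),
      (p = 7 ∨ p = 11 ∨ p = 19 ∨ p = 43 ∨ p = 67 ∨ p = 163) →
      m.Coprime p → χ.IsPrimitive → χ.IsQuadratic → (k = (p + 1) / 4 ∨ k = (3 * p - 1) / 4) →
      2 ≤ k → k ≤ p - 2 → χ (-1) * (-1) ^ k = -1 →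
      ∀ (r e : ℕ), r.Prime → r ≠ 2 → r ≠ p → e ≤ 1 →
      ∃ (𝔽 : Type) (_ : Field 𝔽) (_ : CharP 𝔽 p) (ι : ℤ_[p] →+* 𝔽)
        (M : ℕ → Submodule 𝔽 (PowerSeries 𝔽)) (w : PowerSeries 𝔽 → ℕ) (Θ : PowerSeries 𝔽 →ₗ[𝔽] PowerSeries 𝔽)
        (G T : PowerSeries 𝔽),
        (∀ (g : PowerSeries 𝔽) (n : ℕ), coeff n (Θ g) = (n : 𝔽) * coeff n g) ∧
        (∀ (g : PowerSeries 𝔽) (j : ℕ), g ∈ M j → g ≠ 0 → w g ≤ j ∧ (p - 1) ∣ (j - w g)) ∧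
        (∀ (g : PowerSeries 𝔽) (j : ℕ), g ∈ M j → g ≠ 0 → g ∈ M (w g)) ∧
        (∀ g ∈ M 0, g = C (constantCoeff g)) ∧
        (∀ (g : PowerSeries 𝔽) (j : ℕ), g ∈ M j → Θ g ∈ M (j + p + 1)) ∧
        (∀ (g : PowerSeries 𝔽) (j : ℕ), g ∈ M j → g ≠ 0 → ¬ p ∣ w g → Θ g ≠ 0 ∧ w (Θ g) = w g + p + 1) ∧
        G * T ∈ M (k + (p + 1) / 2) ∧ T ≠ 0 ∧ (∀ j : ℕ, coeff j T ≠ 0 → p ∣ j) ∧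
        (∀ a : ℕ, coeff a G ≠ 0 →
          m ∣ a ∧ a / m % 4 = 3 ∧ (∀ q : ℕ, q.Prime → q ∣ m → q ≠ 2 → jacobiSym (-((a / m : ℕ) : ℤ)) q = 1) ∧
            (2 ∣ m → a / m % 8 = 7) ∧ r ^ e ∣ a / m ∧ ¬ r ^ (e + 1) ∣ a / m) ∧
        (∀ (n₀ f : ℕ) (K : Type) [Field K] [NumberField K] (εK : DirichletCharacter ℚ_[p] (NumberField.discr K).natAbs),
          Squarefree n₀ → n₀ % 4 = 3 → 0 < f →
          (m ∣ m * (n₀ * f ^ 2) ∧ m * (n₀ * f ^ 2) / m % 4 = 3 ∧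
            (∀ q : ℕ, q.Prime → q ∣ m → q ≠ 2 → jacobiSym (-((m * (n₀ * f ^ 2) / m : ℕ) : ℤ)) q = 1) ∧
            (2 ∣ m → m * (n₀ * f ^ 2) / m % 8 = 7) ∧ r ^ e ∣ m * (n₀ * f ^ 2) / m ∧
            ¬ r ^ (e + 1) ∣ m * (n₀ * f ^ 2) / m) →
          IsImaginaryQuadratic K → NumberField.discr K = -(n₀ : ℤ) → IsKroneckerCharacterOf K εK →
          ∃ (t : ℤ) (x : ℤ_[p]), (f = 1 → t = 1) ∧
            (x : ℚ_[p]) = (k : ℚ_[p])⁻¹ * @generalizedBernoulli ℚ_[p] _ _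
              (changeLevel (dvd_mul_right m (NumberField.discr K).natAbs) χ *
                changeLevel (dvd_mul_left (NumberField.discr K).natAbs m) εK).conductor ⟨conductor_ne_zero _⟩ k
              (changeLevel (dvd_mul_right m (NumberField.discr K).natAbs) χ *
                changeLevel (dvd_mul_left (NumberField.discr K).natAbs m) εK).primitiveCharacter ∧
            coeff (m * (n₀ * f ^ 2)) G = (t : 𝔽) * ι x))
    (hcusp : ∀ (p : ℕ) [Fact p.Prime] (m : ℕ) [NeZero m] (χ : DirichletCharacter ℚ_[p] m) (k : ℕ),
      (p = 7 ∨ p = 11 ∨ p = 19 ∨ p = 43 ∨ p = 67 ∨ p = 163) →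
      m.Coprime p → χ.IsPrimitive → χ.IsQuadratic → (k = (p + 1) / 4 ∨ k = (3 * p - 1) / 4) →
      2 ≤ k → k ≤ p - 2 → χ (-1) * (-1) ^ k = -1 →
      ∃ (𝔽 : Type) (_ : Field 𝔽) (_ : CharP 𝔽 p) (ι : ℤ_[p] →+* 𝔽) (G : PowerSeries 𝔽),
        (∀ a : ℕ, coeff a G ≠ 0 →
          m ∣ a ∧ a / m % 4 = 3 ∧ (∀ q : ℕ, q.Prime → q ∣ m → q ≠ 2 → jacobiSym (-((a / m : ℕ) : ℤ)) q = 1) ∧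
            (2 ∣ m → a / m % 8 = 7) ∧ ¬ 3 ∣ a / m) ∧
        (∀ (n₀ f : ℕ) (K : Type) [Field K] [NumberField K] (εK : DirichletCharacter ℚ_[p] (NumberField.discr K).natAbs),
          Squarefree n₀ → n₀ % 4 = 3 → 0 < f →
          (m ∣ m * (n₀ * f ^ 2) ∧ m * (n₀ * f ^ 2) / m % 4 = 3 ∧
            (∀ q : ℕ, q.Prime → q ∣ m → q ≠ 2 → jacobiSym (-((m * (n₀ * f ^ 2) / m : ℕ) : ℤ)) q = 1) ∧
            (2 ∣ m → m * (n₀ * f ^ 2) / m % 8 = 7) ∧ ¬ 3 ∣ m * (n₀ * f ^ 2) / m) →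
          IsImaginaryQuadratic K → NumberField.discr K = -(n₀ : ℤ) → IsKroneckerCharacterOf K εK →
          ∃ (t : ℤ) (x : ℤ_[p]), (f = 1 → t = 1) ∧
            (x : ℚ_[p]) = (k : ℚ_[p])⁻¹ * @generalizedBernoulli ℚ_[p] _ _
              (changeLevel (dvd_mul_right m (NumberField.discr K).natAbs) χ *
                changeLevel (dvd_mul_left (NumberField.discr K).natAbs m) εK).conductor ⟨conductor_ne_zero _⟩ k
              (changeLevel (dvd_mul_right m (NumberField.discr K).natAbs) χ *
                changeLevel (dvd_mul_left (NumberField.discr K).natAbs m) εK).primitiveCharacter ∧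
            coeff (m * (n₀ * f ^ 2)) G = (t : 𝔽) * ι x) ∧
        (G = 0 → ∀ x : ℤ_[p], (x : ℚ_[p]) =
          ((bernoulli (2 * k) / (k.factorial : ℚ) * (m : ℚ) ^ (k - 1) *
            ∏ q ∈ m.primeFactors, ((q : ℚ) - 1) * ((q : ℚ) ^ (2 * k) - 1) / (q : ℚ) ^ (2 * k + 1) : ℚ) : ℚ_[p]) →
          ι x = 0))
    (hExc : ∀ (p : ℕ) [Fact p.Prime] (m : ℕ) [NeZero m] (χ : DirichletCharacter ℚ_[p] m) (k : ℕ),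
      (p = 7 ∨ p = 11 ∨ p = 19 ∨ p = 43 ∨ p = 67 ∨ p = 163) →
      m.Coprime p → χ.IsPrimitive → χ.IsQuadratic → (k = (p + 1) / 4 ∨ k = (3 * p - 1) / 4) →
      2 ≤ k → k ≤ p - 2 → χ (-1) * (-1) ^ k = -1 →
      ¬ ((∀ q : ℕ, q.Prime → q ∣ m → q ≠ 2 → jacobiSym (-(p : ℤ)) q = 1) ∧ (2 ∣ m → p % 8 = 7)) →
      (∃ ℓ : ℕ, ℓ.Prime ∧ ℓ ∣ m ∧ (ℓ % p = 1 ∨ ℓ % p = p - 1)) →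
      ¬ ‖((p - k : ℕ) : ℚ_[p])⁻¹ * generalizedBernoulli (p - k) χ‖ ≤ (p : ℝ)⁻¹ →
      ∃ (K₀ : Type) (_ : Field K₀) (_ : NumberField K₀) (ε₀ : DirichletCharacter ℚ_[p] (NumberField.discr K₀).natAbs),
        IsImaginaryQuadratic K₀ ∧
        (∀ q : ℕ, q.Prime → q ∣ m → ((Ideal.span {(q : ℤ)}).primesOver (𝓞 K₀)).ncard = 2) ∧
        Odd (NumberField.discr K₀) ∧ NumberField.discr K₀ < -4 ∧ IsKroneckerCharacterOf K₀ ε₀ ∧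
        ¬ ‖(k : ℚ_[p])⁻¹ * @generalizedBernoulli ℚ_[p] _ _
            (changeLevel (dvd_mul_right m (NumberField.discr K₀).natAbs) χ *
              changeLevel (dvd_mul_left (NumberField.discr K₀).natAbs m) ε₀).conductor ⟨conductor_ne_zero _⟩ k
            (changeLevel (dvd_mul_right m (NumberField.discr K₀).natAbs) χ *
              changeLevel (dvd_mul_left (NumberField.discr K₀).natAbs m) ε₀).primitiveCharacter‖ ≤ (p : ℝ)⁻¹) :
    ∀ (W : WeierstrassCurve ℚ) [W.IsElliptic] [W.IsGloballyMinimal] (p : ℕ) [Fact p.Prime], W.HasCM → CMRamified W p → 5 ≤ p →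
      W.analyticRank = 1 → ∀ (f : ℕ) [NeZero f] (ψ : DirichletCharacter ℚ_[p] f) (ω : DirichletCharacter ℚ_[p] p), ψ.Odd →
      IsTeichmullerCharacter ω →
      (∀ ℓ : ℕ, ℓ.Prime → ¬ (ℓ ∣ p * W.conductorNorm ℤ) →
        ‖((W.LFunction ℓ : ℤ) : ℚ_[p]) - (ψ (ℓ : ZMod f) + ψ⁻¹ (ℓ : ZMod f) * ω (ℓ : ZMod p))‖ < 1) →
      ¬ ‖bernoulliOnePrim ψ⁻¹‖ ≤ (p : ℝ)⁻¹ →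
      ∃ (K : Type) (_ : Field K) (_ : NumberField K) (εK : DirichletCharacter ℚ_[p] (NumberField.discr K).natAbs),
        IsImaginaryQuadratic K ∧ SatisfiesHeegnerHypothesis (W.conductorNorm ℤ) K ∧ Odd (NumberField.discr K) ∧
        NumberField.discr K < -4 ∧ IsKroneckerCharacterOf K εK ∧
        ¬ ‖bernoulliOnePrim (bernoulliCharTwo ψ εK ω)‖ ≤ (p : ℝ)⁻¹ :=
  HeegnerFieldSupply.stubC_of_atP_of_cuspSeed_of_exc (ThetaCycle.atP_six_of_cutForm hcut) (cuspSeed_six_of_cutForm hcusp) hExc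

/-! ## §4 END STATE (registry v22 with `stub_atP`, `stub_cuspSeed` replaced by (CutForm⁶), (CuspCutForm⁶)) -/

/-- **END STATE.** The crux `PrintCFram.BottomClassIndexLawFiveLe` BY NAME from: the five refereed print facts (`hprints5` = `stub_prints5`),
Kriz–Li Thm 1.20 (`hKL` = `stub_krizLi`), (CutForm⁶) (`hcut`), (CuspCutForm⁶) (`hcusp`), (SeedOffExc⁶) (`hExc` = `stub_seedOffExc`), B1-level
(`hLevel` = `stub_bsdp_of_level`), B1-sha (`hSha` = `stub_bsdp_of_sha`) — registry texts VERBATIM except the two typing items. One line: LEAD g11's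
`EisensteinEndStateV19Binders.bottomClassIndexLawFiveLe_of_prints4_of_mazurWiles_of_krizLi_of_cover_of_level_of_sha` (p677037) with the C slot fed by §3.
CONDITIONAL on seven hypotheses; BSD is not proved by any of this. [cite: KrizLi2019, Thm. 1.20 (pp. 7–8)] [cite: MazurWiles1984, Thm. 2 (p. 216)]
[cite: Cohen1975, Thm. 3.1] [cite: Katz1973, §1.6] [cite: BurungaleKobayashiNakamuraOta2026, §1.4] -/
theorem bottomClassIndexLawFiveLe_of_prints5_of_krizLi_of_cutForm_of_cuspCutForm_of_exc_of_level_of_sha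
    (hprints5 :
      (Hsieh2014.thmA_exists_isHsiehLFunction_unrPeriod_anyLevel ∧
        LiuZhangZhang2018.thm151_thm153_modularCurve_heegnerVector_additive ∧
        Summit.BirchSwinnertonDyer.BirchSwinnertonDyer.Theses.UniversalToricDescent.ToricPublishedInputs ∧
        bsdTriple_of_hasCM_of_L_one_ne_zero) ∧
      Literature.NumberTheory.NumberFields.MazurWiles1984.thm2_card_oddChiClassGroup_eq_bernoulli)
    (hKL : thm120_padicLogHeegner_unit_of_bernoulli)
    (hcut : ∀ (p : ℕ) [Fact p.Prime] (m : ℕ) [NeZero m] (χ : DirichletCharacter ℚ_[p] m) (k : ℕ),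
      (p = 7 ∨ p = 11 ∨ p = 19 ∨ p = 43 ∨ p = 67 ∨ p = 163) →
      m.Coprime p → χ.IsPrimitive → χ.IsQuadratic → (k = (p + 1) / 4 ∨ k = (3 * p - 1) / 4) →
      2 ≤ k → k ≤ p - 2 → χ (-1) * (-1) ^ k = -1 →
      ∀ (r e : ℕ), r.Prime → r ≠ 2 → r ≠ p → e ≤ 1 →
      ∃ (𝔽 : Type) (_ : Field 𝔽) (_ : CharP 𝔽 p) (ι : ℤ_[p] →+* 𝔽)
        (M : ℕ → Submodule 𝔽 (PowerSeries 𝔽)) (w : PowerSeries 𝔽 → ℕ) (Θ : PowerSeries 𝔽 →ₗ[𝔽] PowerSeries 𝔽)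
        (G T : PowerSeries 𝔽),
        (∀ (g : PowerSeries 𝔽) (n : ℕ), coeff n (Θ g) = (n : 𝔽) * coeff n g) ∧
        (∀ (g : PowerSeries 𝔽) (j : ℕ), g ∈ M j → g ≠ 0 → w g ≤ j ∧ (p - 1) ∣ (j - w g)) ∧
        (∀ (g : PowerSeries 𝔽) (j : ℕ), g ∈ M j → g ≠ 0 → g ∈ M (w g)) ∧
        (∀ g ∈ M 0, g = C (constantCoeff g)) ∧
        (∀ (g : PowerSeries 𝔽) (j : ℕ), g ∈ M j → Θ g ∈ M (j + p + 1)) ∧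
        (∀ (g : PowerSeries 𝔽) (j : ℕ), g ∈ M j → g ≠ 0 → ¬ p ∣ w g → Θ g ≠ 0 ∧ w (Θ g) = w g + p + 1) ∧
        G * T ∈ M (k + (p + 1) / 2) ∧ T ≠ 0 ∧ (∀ j : ℕ, coeff j T ≠ 0 → p ∣ j) ∧
        (∀ a : ℕ, coeff a G ≠ 0 →
          m ∣ a ∧ a / m % 4 = 3 ∧ (∀ q : ℕ, q.Prime → q ∣ m → q ≠ 2 → jacobiSym (-((a / m : ℕ) : ℤ)) q = 1) ∧
            (2 ∣ m → a / m % 8 = 7) ∧ r ^ e ∣ a / m ∧ ¬ r ^ (e + 1) ∣ a / m) ∧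
        (∀ (n₀ f : ℕ) (K : Type) [Field K] [NumberField K] (εK : DirichletCharacter ℚ_[p] (NumberField.discr K).natAbs),
          Squarefree n₀ → n₀ % 4 = 3 → 0 < f →
          (m ∣ m * (n₀ * f ^ 2) ∧ m * (n₀ * f ^ 2) / m % 4 = 3 ∧
            (∀ q : ℕ, q.Prime → q ∣ m → q ≠ 2 → jacobiSym (-((m * (n₀ * f ^ 2) / m : ℕ) : ℤ)) q = 1) ∧
            (2 ∣ m → m * (n₀ * f ^ 2) / m % 8 = 7) ∧ r ^ e ∣ m * (n₀ * f ^ 2) / m ∧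
            ¬ r ^ (e + 1) ∣ m * (n₀ * f ^ 2) / m) →
          IsImaginaryQuadratic K → NumberField.discr K = -(n₀ : ℤ) → IsKroneckerCharacterOf K εK →
          ∃ (t : ℤ) (x : ℤ_[p]), (f = 1 → t = 1) ∧
            (x : ℚ_[p]) = (k : ℚ_[p])⁻¹ * @generalizedBernoulli ℚ_[p] _ _
              (changeLevel (dvd_mul_right m (NumberField.discr K).natAbs) χ *
                changeLevel (dvd_mul_left (NumberField.discr K).natAbs m) εK).conductor ⟨conductor_ne_zero _⟩ k
              (changeLevel (dvd_mul_right m (NumberField.discr K).natAbs) χ *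
                changeLevel (dvd_mul_left (NumberField.discr K).natAbs m) εK).primitiveCharacter ∧
            coeff (m * (n₀ * f ^ 2)) G = (t : 𝔽) * ι x))
    (hcusp : ∀ (p : ℕ) [Fact p.Prime] (m : ℕ) [NeZero m] (χ : DirichletCharacter ℚ_[p] m) (k : ℕ),
      (p = 7 ∨ p = 11 ∨ p = 19 ∨ p = 43 ∨ p = 67 ∨ p = 163) →
      m.Coprime p → χ.IsPrimitive → χ.IsQuadratic → (k = (p + 1) / 4 ∨ k = (3 * p - 1) / 4) →
      2 ≤ k → k ≤ p - 2 → χ (-1) * (-1) ^ k = -1 →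
      ∃ (𝔽 : Type) (_ : Field 𝔽) (_ : CharP 𝔽 p) (ι : ℤ_[p] →+* 𝔽) (G : PowerSeries 𝔽),
        (∀ a : ℕ, coeff a G ≠ 0 →
          m ∣ a ∧ a / m % 4 = 3 ∧ (∀ q : ℕ, q.Prime → q ∣ m → q ≠ 2 → jacobiSym (-((a / m : ℕ) : ℤ)) q = 1) ∧
            (2 ∣ m → a / m % 8 = 7) ∧ ¬ 3 ∣ a / m) ∧
        (∀ (n₀ f : ℕ) (K : Type) [Field K] [NumberField K] (εK : DirichletCharacter ℚ_[p] (NumberField.discr K).natAbs),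
          Squarefree n₀ → n₀ % 4 = 3 → 0 < f →
          (m ∣ m * (n₀ * f ^ 2) ∧ m * (n₀ * f ^ 2) / m % 4 = 3 ∧
            (∀ q : ℕ, q.Prime → q ∣ m → q ≠ 2 → jacobiSym (-((m * (n₀ * f ^ 2) / m : ℕ) : ℤ)) q = 1) ∧
            (2 ∣ m → m * (n₀ * f ^ 2) / m % 8 = 7) ∧ ¬ 3 ∣ m * (n₀ * f ^ 2) / m) →
          IsImaginaryQuadratic K → NumberField.discr K = -(n₀ : ℤ) → IsKroneckerCharacterOf K εK →
          ∃ (t : ℤ) (x : ℤ_[p]), (f = 1 → t = 1) ∧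
            (x : ℚ_[p]) = (k : ℚ_[p])⁻¹ * @generalizedBernoulli ℚ_[p] _ _
              (changeLevel (dvd_mul_right m (NumberField.discr K).natAbs) χ *
                changeLevel (dvd_mul_left (NumberField.discr K).natAbs m) εK).conductor ⟨conductor_ne_zero _⟩ k
              (changeLevel (dvd_mul_right m (NumberField.discr K).natAbs) χ *
                changeLevel (dvd_mul_left (NumberField.discr K).natAbs m) εK).primitiveCharacter ∧
            coeff (m * (n₀ * f ^ 2)) G = (t : 𝔽) * ι x) ∧
        (G = 0 → ∀ x : ℤ_[p], (x : ℚ_[p]) =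
          ((bernoulli (2 * k) / (k.factorial : ℚ) * (m : ℚ) ^ (k - 1) *
            ∏ q ∈ m.primeFactors, ((q : ℚ) - 1) * ((q : ℚ) ^ (2 * k) - 1) / (q : ℚ) ^ (2 * k + 1) : ℚ) : ℚ_[p]) →
          ι x = 0))
    (hExc : ∀ (p : ℕ) [Fact p.Prime] (m : ℕ) [NeZero m] (χ : DirichletCharacter ℚ_[p] m) (k : ℕ),
      (p = 7 ∨ p = 11 ∨ p = 19 ∨ p = 43 ∨ p = 67 ∨ p = 163) →
      m.Coprime p → χ.IsPrimitive → χ.IsQuadratic → (k = (p + 1) / 4 ∨ k = (3 * p - 1) / 4) →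
      2 ≤ k → k ≤ p - 2 → χ (-1) * (-1) ^ k = -1 →
      ¬ ((∀ q : ℕ, q.Prime → q ∣ m → q ≠ 2 → jacobiSym (-(p : ℤ)) q = 1) ∧ (2 ∣ m → p % 8 = 7)) →
      (∃ ℓ : ℕ, ℓ.Prime ∧ ℓ ∣ m ∧ (ℓ % p = 1 ∨ ℓ % p = p - 1)) →
      ¬ ‖((p - k : ℕ) : ℚ_[p])⁻¹ * generalizedBernoulli (p - k) χ‖ ≤ (p : ℝ)⁻¹ →
      ∃ (K₀ : Type) (_ : Field K₀) (_ : NumberField K₀) (ε₀ : DirichletCharacter ℚ_[p] (NumberField.discr K₀).natAbs),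
        IsImaginaryQuadratic K₀ ∧
        (∀ q : ℕ, q.Prime → q ∣ m → ((Ideal.span {(q : ℤ)}).primesOver (𝓞 K₀)).ncard = 2) ∧
        Odd (NumberField.discr K₀) ∧ NumberField.discr K₀ < -4 ∧ IsKroneckerCharacterOf K₀ ε₀ ∧
        ¬ ‖(k : ℚ_[p])⁻¹ * @generalizedBernoulli ℚ_[p] _ _
            (changeLevel (dvd_mul_right m (NumberField.discr K₀).natAbs) χ *
              changeLevel (dvd_mul_left (NumberField.discr K₀).natAbs m) ε₀).conductor ⟨conductor_ne_zero _⟩ k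
            (changeLevel (dvd_mul_right m (NumberField.discr K₀).natAbs) χ *
              changeLevel (dvd_mul_left (NumberField.discr K₀).natAbs m) ε₀).primitiveCharacter‖ ≤ (p : ℝ)⁻¹)
    (hLevel :
      ∀ (W : WeierstrassCurve ℚ) [W.IsElliptic] [W.IsGloballyMinimal] (p : ℕ) [Fact p.Prime],
        W.HasCM → CMRamified W p → 5 ≤ p → W.analyticRank = 1 →
        ∀ P : W.toAffine.Point, ¬ IsOfFinAddOrder P →
          (∀ R : W.toAffine.Point, ∃ (k : ℤ) (T : W.toAffine.Point), IsOfFinAddOrder T ∧ R = k • P + T) →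
          (∃ Q : (W.baseChange ℚ_[p]).toAffine.Point, p • Q = W.toPadicPoint p P) →
          BSDp W p)
    (hSha :
      ∀ (W : WeierstrassCurve ℚ) [W.IsElliptic] [W.IsGloballyMinimal] (p : ℕ) [Fact p.Prime],
        W.HasCM → CMRamified W p → 5 ≤ p → W.analyticRank = 1 →
        (∃ s ∈ W.sha, s ≠ 0 ∧ p • s = 0) → BSDp W p) :
    Summit.BirchSwinnertonDyer.BirchSwinnertonDyer.Theses.PrintCFram.BottomClassIndexLawFiveLe :=
  EisensteinEndStateV19Binders.bottomClassIndexLawFiveLe_of_prints4_of_mazurWiles_of_krizLi_of_cover_of_level_of_sha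
    hprints5.1 hprints5.2 hKL (stubC_of_cutForm_of_cuspCutForm_of_exc hcut hcusp hExc) hLevel hSha

end Summit.BirchSwinnertonDyer.BirchSwinnertonDyer.Theorems.PrintCFram.CuspSeed

end
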